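import Summits.BirchSwinnertonDyer.BirchSwinnertonDyer.Theorems.CongruentShaFreeCutTwoAdicBDPExistsValueUpTo
import HarnessLib

set_option linter.dupNamespace false -- `Summit.BirchSwinnertonDyer.BirchSwinnertonDyer.Theorems.…` (summit = sub)
set_option autoImplicit false

/-!
# Route `CongruentShaFreeCut` (rung S2) — the VALUE HALF of the BDP road as ONE NAMED `Prop`: the generalised
# `p`-adic Waldspurger / BDP formula at the trivial character for a modular elliptic curve AT A PRIME DIVIDING
# THE LEVEL (`p ∣ N` allowed), up to a non-zero constant — and its readings for the registered stubs

Cell `bsd-cn100`, prover seat `bsd-cn100-transfer` (g11), plan g15 RULING-3 (e2) (2026-08-27T01:16:47Z): «MEMO-13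
§5 value side: the typed STATEMENT of the generalised Waldspurger/BDP main identity at `p ∣ N` as the exact Prop the
EV♯∃ value clause needs (statement-only, `@[conjecture]`-tagged under Theorems/, `--as helper`), so the research
frontier of 19079 is ONE NAMED Prop per half». Supports, does not close, stmt-BirchSwinnertonDyer-19079. ONE
DEFINITION (`@[conjecture]`, nothing asserted) + two reading theorems; imports no `Theses` module directly.
PARTITION: none — RANK axis. HONEST FRAMING: in print the formula is BDP 2013 Thm. 5.13 / Castella–Hsieh 2018
Thm. A / CGLS 2022 Thm. 5.1.3, all with `p ∤ N` (or `p ∥ N` variants); at an ADDITIVE prime (`p² ∣ N`, e.g.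
`E_n` at `2`, the `j = 0` curves at `3`) it is OPEN — this file only NAMES it.

* `BDPWaldspurgerFormulaUpTo p` — for every modular elliptic curve `E/ℚ` of conductor `N`, Heegner field `K`
  with `p` split, `p`-adic anticyclotomic datum `(κ, γ)`, Heegner point `P`, and EVERY ♯-frame
  `IsBDPLFunctionUpTo C ι' v κ γ f_E Ω_K Ω_p 𝓛` (`C, Ω_K ≠ 0`):
  `𝓛(𝟙) = u · c⁻² · (1 − a_p p⁻¹ + [p ∤ N] p⁻¹)² · (log_ω P)²` with `u ∈ ℂ_pˣ`. By LEMMA R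
  (`…BDPUpToRigidityUnconditional`) the quantification over frames costs one frame.
* `twoAdicBDPValueAtOneUpTo_of_waldspurger` — the registered-shape stub (LB-bdp♯) `TwoAdicBDPValueAtOneUpTo`
  of `E_n` at `2` is its specialisation; `bdpExistsWithValueUpTo_of_exists_of_waldspurger` — the ∃∧ stub
  `TwoAdicBDPElementExistsWithValueUpTo` (v6cq) ⟸ (LB-exist♯) ∧ `BDPWaldspurgerFormulaUpTo 2`. So the research
  frontier of stmt-19079's BDP road is ONE NAMED `Prop` per half: existence (LB-exist♯, a construction at the
  additive prime) and value (`BDPWaldspurgerFormulaUpTo 2`), next to (res) and (LB-wan♯).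

References: [BertoliniDarmonPrasanna2013] Thm. 5.13; [CastellaHsieh2018] Thm. A; [CastellaGrossiLeeSkinner2022]
Thm. 5.1.3; [Castella2018] Thm. 3.1 (the frame). Shapes only; nothing asserted.
-/

noncomputable section

open scoped Classical

open PowerSeries WeierstrassCurve NumberField IsDedekindDomain Field Literature.NumberTheory.EllipticCurves
  Literature.NumberTheory.EllipticCurves.ModularForms Literature.NumberTheory.QuadraticFields
  Literature.NumberTheory.EllipticCurves.Castella2018
open Literature.NumberTheory.GaloisRepresentations Literature.NumberTheory.GaloisCohomology
open Summit.BirchSwinnertonDyer.BirchSwinnertonDyer.Theorems.CongruentShaFreeCutTwoAdicBDPTripleUpTo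
  (TwoAdicBDPElementExistsUpTo TwoAdicBDPValueAtOneUpTo)
open Summit.BirchSwinnertonDyer.BirchSwinnertonDyer.Theorems.CongruentShaFreeCutTwoAdicBDPExistsValueUpTo
  (TwoAdicBDPElementExistsWithValueUpTo bdpExistsWithValueUpTo_of_exists_of_value)

namespace Summit.BirchSwinnertonDyer.BirchSwinnertonDyer.Theorems.CongruentShaFreeCutBDPWaldspurgerFormula

/-- **The generalised `p`-adic Waldspurger / BDP formula at the trivial character, at a prime that MAY DIVIDE
THE LEVEL, up to a non-zero constant** (the VALUE HALF of the BDP road as one named `Prop`). For every modular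
elliptic curve `E/ℚ` of conductor `N` (modular parametrisation datum `Dt`, Manin constant `c = Dt.c`, newform
`f_E = Dt.f`), every imaginary quadratic `K` with the Heegner hypothesis for `N` in which `p = v v̄` splits,
embedding datum `ι'` and `e : K → ℚ_p` inducing `v`, anticyclotomic `ℤ_p`-datum `κ` with topological generator
`γ`, the Heegner point `P ∈ E(K)` (`w(P) = heegnerPointComplex Dt H`), and EVERY ♯-frame
`IsBDPLFunctionUpTo C ι' v κ γ f_E Ω_K Ω_p 𝓛` with `Ω_K ≠ 0`, `Ω_p ∈ R₀ˣ`, `C ≠ 0`: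
`𝓛(𝟙) = u · c⁻² · (1 − a_p·p⁻¹ + [p ∤ N]·p⁻¹)² · (log_ω P)²` for some `u ∈ ℂ_p`, `u ≠ 0`
(`a_p = E.LFunction p`, the Dirichlet coefficient; general Euler factor kept). IN PRINT for `p ∤ N` (BDP 2013
Thm. 5.13, `p` split, `c` odd…; Castella–Hsieh 2018 Thm. A; CGLS 2022 Thm. 5.1.3) — OPEN at additive `p`
(`p² ∣ N`). A STATEMENT ONLY; nothing asserted. [cite: BertoliniDarmonPrasanna2013, Thm. 5.13 (shape; p ∤ N there; nothing asserted)]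
[cite: CastellaGrossiLeeSkinner2022, Thm. 5.1.3 (shape; p ∤ 2N there; nothing asserted)] -/
@[conjecture] def BDPWaldspurgerFormulaUpTo (p : ℕ) [Fact p.Prime] : Prop :=
  ∀ (E : WeierstrassCurve ℚ) [E.IsElliptic] [E.IsGloballyMinimal]
    (ι' : PadicAlgCl p ≃+* ℂ) (K : Type) [Field K] [NumberField K] (N : ℕ) [NeZero N]
    (Dt : ModularParametrizationData E N)
    (H : HeegnerDatum N (NumberField.discr K)) (w : InfinitePlace K) (e : K →+* ℚ_[p])
    (v : HeightOneSpectrum (𝓞 K)) (κ : ZpExtension K p) (γ : absoluteGaloisGroup K)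
    [Fact (κ.IsTopGenerator γ)] (P : (E.baseChange K).toAffine.Point),
  E.conductorNorm ℤ = N → IsImaginaryQuadratic K →
  SatisfiesHeegnerHypothesis N K → ((Ideal.span {(p : ℤ)}).primesOver (𝓞 K)).ncard = 2 →
  ((p : ℕ) : 𝓞 K) ∈ v.asIdeal →
  (∀ (w' : InfinitePlace K) (k : 𝓞 K), k ∈ v.asIdeal ↔ ‖ι'.symm (w'.embedding (k : K))‖ < 1) →
  κ.IsAnticyclotomic →
  WeierstrassCurve.Affine.Point.map w.embedding.toRatAlgHom P = heegnerPointComplex Dt H →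
  (∀ k : 𝓞 K, k ∈ v.asIdeal ↔ ‖e (k : K)‖ < 1) →
  ∀ (ΩK : ℂ) (Ωp : (unrIntegers p)ˣ) (C : ℂ_[p]) (L : UnrSeries p),
    ΩK ≠ 0 → C ≠ 0 → IsBDPLFunctionUpTo C ι' v κ γ Dt.f ΩK ((Ωp : unrIntegers p) : ℂ_[p]) L →
    ∃ u : ℂ_[p], u ≠ 0 ∧ L.HasValueAt 0
      (u * algebraMap ℚ_[p] ℂ_[p] (((Dt.c : ℚ_[p])⁻¹) ^ 2 *
          (1 - (E.LFunction p : ℚ_[p]) * (p : ℚ_[p])⁻¹ +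
            (if p ∣ N then 0 else (p : ℚ_[p])⁻¹)) ^ 2 *
          (padicLogOmega E p e P) ^ 2))

/-- **Reading: (LB-bdp♯) for `E_n` at `2` is the specialisation of `BDPWaldspurgerFormulaUpTo 2`** to the
congruent number curves (the registered-shape `TwoAdicBDPValueAtOneUpTo`, token-for-token). [folklore] -/
theorem twoAdicBDPValueAtOneUpTo_of_waldspurger (h : BDPWaldspurgerFormulaUpTo 2) :
    TwoAdicBDPValueAtOneUpTo := by
  intro n _ _ _ ι' K _ _ N _ Dt H w e v κ γ _ P hN hK hHN hsplit hv2 hι' hκ hP he ΩK Ωp C L hΩK hC hL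
  have h2 : ((Ideal.span {((2 : ℕ) : ℤ)}).primesOver (𝓞 K)).ncard = 2 := by simpa using hsplit
  obtain ⟨u, hu, hval⟩ := h (congruentNumberCurve n) ι' K N Dt H w e v κ γ P hN hK hHN h2 hv2 hι' hκ hP he
    ΩK Ωp C L hΩK hC hL
  refine ⟨u, hu, ?_⟩
  simpa using hval

/-- **Reading: the ∃∧ stub of line v6cq, `TwoAdicBDPElementExistsWithValueUpTo` (EV♯∃), follows from the
existence half (LB-exist♯) `TwoAdicBDPElementExistsUpTo` and the value half `BDPWaldspurgerFormulaUpTo 2`.**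
So the research frontier of the BDP road of stmt-19079 is ONE NAMED `Prop` per half (next to (res) and
(LB-wan♯), the latter honest for one tuple by LEMMA R∞). [folklore] -/
theorem bdpExistsWithValueUpTo_of_exists_of_waldspurger (hE : TwoAdicBDPElementExistsUpTo)
    (hW : BDPWaldspurgerFormulaUpTo 2) : TwoAdicBDPElementExistsWithValueUpTo :=
  bdpExistsWithValueUpTo_of_exists_of_value hE (twoAdicBDPValueAtOneUpTo_of_waldspurger hW)

end Summit.BirchSwinnertonDyer.BirchSwinnertonDyer.Theorems.CongruentShaFreeCutBDPWaldspurgerFormula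

end
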